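import Summits.QuantumFields.YangMills.Theorems.BalabanUVNodesN08AlphaAbelianLift
import Summits.QuantumFields.Balaban3D.Carriers.Group
import Literature.MathematicalPhysics.QuantumFieldTheory.Balaban1983to89.BlockAveragingExpMeanLog
import Literature.MathematicalPhysics.QuantumFieldTheory.Balaban1983to89.BlockAveraging
import HarnessLib

/-!
# `AlphaInputsT3ACv3AbelianEML` — STRATEGY B for 2′, toward (D6R-CHARGED): THE (0.4) BLOCK AVERAGE OF AN **ABELIAN** CONFIGURATION — part 1: parallel transport along torus
# walks, the loop variables and the axial factor of `b ↦ gexp(a_b)` are `gexp` of the signed walk sums of the one-form `a` — lane `pub-balaban3d`, seat alpha-2 (g3)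

WHY (HOME `D6L-STATUS-alpha2-g3.md` §4; folder NOTES «Open questions»).  Row r3 of 2′ (multi-level (68)) asks the `s`-fold `blockAvg ℰp`-averages of the class element to be regular on
the plaquettes inside `Λ_i(h)`; for the lane's abelian profiles this needs the (0.4) calculus for abelian configurations: `Ū(c) = exp[mean_i (1/i)log U(loop_i)]·U(c)` is again
abelian, with the LINEARLY averaged one-form.  THIS FILE (generic torus `P`, level `j`, group as printed `𝔊`, direction `X ∈ 𝔤`): `gexpAt` (the abelian configuration of a real
one-form on the level-`j` bonds), `wsum` (the signed sum of the one-form along the walk spelled by a word), ★ `holAt_walk_gexpAt` (transport = `gexp` of the walk sum),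
`loopHol_gexpAt` (the (0.4) loop variables), `axialAvg_gexpAt` (the axial factor).  Part 2 (the `exp[mean log]` step on `SU(N)` and the averaged one-form) is the successor's.
HONEST FRAMING.  Kernel algebra of one-parameter subgroups; nothing of [B10]∕[7]∕[4]'s estimates asserted; count-neutral helper toward R3 2′ (`stub_laneRecordsV3`, items 19935∕19936);
nothing about d = 4, the continuum, or a mass gap.

References: T. Bałaban, Commun. Math. Phys. 109 (1987) 249–301 [Balaban1987RG1] ((0.4) p.253); CMP 98 (1985) 17–51 [Balaban1985Averaging] ((9) p.18).
-/

set_option autoImplicit false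

noncomputable section

namespace Summit.QuantumFields.YangMills.Theorems.AbelianEML

open Literature.MathematicalPhysics.QuantumFieldTheory.Balaban1983to89
open Literature.MathematicalPhysics.QuantumFieldTheory.Balaban1983to89.T4Continuum
open Literature.MathematicalPhysics.QuantumFieldTheory.Balaban1983to89.BlockAveraging (loopHol off Idx)
open Literature.MathematicalPhysics.QuantumFieldTheory.Balaban1985CMP102.Setting
open Summit.QuantumFields.Balaban3D.Carriers
open NormedSpace
open Summit.QuantumFields.YangMills.Theorems.BalabanUVNodesN08AlphaAbelianLift (gexp gexp_add gexp_inv rho_gexp)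

variable {P : Params} {j : ℕ} {G : Type} [GaugeGroup G] [MeasurableSpace G] (𝔊 : GroupModel G) {X : Matrix (Fin 𝔊.N) (Fin 𝔊.N) ℂ} (hX : X ∈ 𝔊.lie)

/-! ## §1 Abelian configurations at level `j` and signed walk sums -/

/-- **THE ABELIAN CONFIGURATION OF A REAL ONE-FORM ON THE LEVEL-`j` BONDS**: `b ↦ gexp(a_b)` along the fixed direction `X ∈ 𝔤` (NODE O's `gexpCfg` is the case `j = 0`).
[cite: Balaban1985Averaging, (3) p.18 + (22) p.21] -/
def gexpAt (a : PBond P j → ℝ) : GaugeField P j G := fun b => gexp 𝔊 hX (a b)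

/-- **THE SIGNED SUM OF A ONE-FORM ALONG THE WALK SPELLED BY A WORD** from a base site (`+a_b` for a bond traversed forward, `−a_b` backward) — the abelian path functional of the
torus walk `T4Continuum.walk`. [cite: Balaban1985Averaging, (9) p.18] -/
def wsum (a : PBond P j → ℝ) : Site P j → List (Letter P.d) → ℝ
  | _, [] => 0
  | x, (μ, true) :: w => a ⟨x, μ⟩ + wsum a (x.shift μ) w
  | x, (μ, false) :: w => -a ⟨x.unshift μ, μ⟩ + wsum a (x.unshift μ) w

/-- `wsum` of the empty word. [folklore] -/
@[simp] theorem wsum_nil (a : PBond P j → ℝ) (x : Site P j) : wsum a x [] = 0 := rfl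

/-- `wsum` of a forward letter. [folklore] -/
@[simp] theorem wsum_cons_true (a : PBond P j → ℝ) (x : Site P j) (μ : Fin P.d) (w : List (Letter P.d)) :
    wsum a x ((μ, true) :: w) = a ⟨x, μ⟩ + wsum a (x.shift μ) w := rfl

/-- `wsum` of a backward letter. [folklore] -/
@[simp] theorem wsum_cons_false (a : PBond P j → ℝ) (x : Site P j) (μ : Fin P.d) (w : List (Letter P.d)) :
    wsum a x ((μ, false) :: w) = -a ⟨x.unshift μ, μ⟩ + wsum a (x.unshift μ) w := rfl

/-- `gexp 0 = 1`. [folklore] -/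
theorem gexp_zero : gexp 𝔊 hX 0 = 1 := by
  apply 𝔊.injective
  rw [rho_gexp, map_one, Complex.ofReal_zero, zero_smul, NormedSpace.exp_zero]

/-- **★ PARALLEL TRANSPORT OF AN ABELIAN CONFIGURATION ALONG A WALK IS `gexp` OF THE WALK SUM.** [cite: Balaban1985Averaging, (9) p.18] -/
theorem holAt_walk_gexpAt (a : PBond P j → ℝ) : ∀ (w : List (Letter P.d)) (x : Site P j),
    holAt (gexpAt 𝔊 hX a) (walk x w) = gexp 𝔊 hX (wsum a x w)
  | [], x => by rw [wsum_nil, gexp_zero]; rfl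
  | (μ, true) :: w, x => by
    rw [wsum_cons_true, ← gexp_add, ← holAt_walk_gexpAt a w (x.shift μ)]
    rfl
  | (μ, false) :: w, x => by
    rw [wsum_cons_false, ← gexp_add, ← holAt_walk_gexpAt a w (x.unshift μ), ← gexp_inv]
    rfl

/-- **THE (0.4) LOOP SUM** of the one-form at the coarse bond `c` and index `i`: the signed sum along the loop word `Γ ∪ [x,x′] ∪ (−Γ′) ∪ (−c)` from `emb c₋`. [cite: Balaban1987RG1, (0.4) p.253] -/
def loopSum (a : PBond P j → ℝ) (c : PBond P (j + 1)) (i : Idx P) : ℝ :=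
  wsum a (emb c.src) (loopWord P.L c.dir (off i.1) i.2.1 i.2.2)

/-- **THE AXIAL SUM**: the sum of the one-form along the straight line of `L` bonds from `emb c₋` in direction `dir c`. [cite: Balaban1985Averaging, (14) p.19] -/
def axialSum (a : PBond P j → ℝ) (c : PBond P (j + 1)) : ℝ :=
  wsum a (emb c.src) (List.replicate P.L (c.dir, true))

/-- **THE (0.4) LOOP VARIABLES OF AN ABELIAN CONFIGURATION** are `gexp` of the loop sums. [cite: Balaban1987RG1, (0.4) p.253] -/
theorem loopHol_gexpAt (a : PBond P j → ℝ) (c : PBond P (j + 1)) (i : Idx P) :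
    loopHol (gexpAt 𝔊 hX a) c i = gexp 𝔊 hX (loopSum a c i) :=
  holAt_walk_gexpAt 𝔊 hX a _ _

/-- **THE AXIAL FACTOR OF AN ABELIAN CONFIGURATION** is `gexp` of the axial sum. [cite: Balaban1985Averaging, (14) p.19] -/
theorem axialAvg_gexpAt (a : PBond P j → ℝ) (c : PBond P (j + 1)) :
    AveragingRT.axialAvg (gexpAt 𝔊 hX a) c = gexp 𝔊 hX (axialSum a c) := by
  rw [axialAvg_eq_holAt_walk]
  exact holAt_walk_gexpAt 𝔊 hX a _ _

/-- The plaquette variables of an abelian configuration at level `j` are `gexp` of the lattice curl. [cite: Balaban1985Averaging, (9) p.19] -/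
theorem plaqHol_gexpAt (a : PBond P j → ℝ) (p : Plaq P j) :
    GaugeField.plaqHol (gexpAt 𝔊 hX a) p = gexp 𝔊 hX (a ⟨p.src, p.μ⟩ + a ⟨p.src.shift p.μ, p.ν⟩ - a ⟨p.src.shift p.ν, p.μ⟩ - a ⟨p.src, p.ν⟩) := by
  simp only [GaugeField.plaqHol, gexpAt, gexp_inv, gexp_add]
  ring_nf

/-! ## §2 The `exp[mean log]` step on `SU(N)`: the (0.4) block average of an abelian configuration is abelian -/

section SUN

open scoped Matrix.Norms.L2Operator
open BlockAveraging (corr Small avgFun blockAvg blockAvg_avg)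
open ExpMeanLog (expMeanLogSU deltaSU coe_ESU_of_small eml_eq_exp_sum)
open Summit.QuantumFields.YangMills.Theorems.BalabanUVNodesN08AlphaAbelianLift (mlog_exp_real_smul)

variable {N : ℕ} [NeZero N] {Y : Matrix (Fin N) (Fin N) ℂ} (hY : Y ∈ (suGroupModel N).lie)

/-- For the group as printed `SU(N)` the realisation is the underlying matrix: `(gexp t : M_N(ℂ)) = exp(tY)`. [folklore] -/
theorem coe_gexp_su (t : ℝ) : ((gexp (suGroupModel N) hY t : Matrix.specialUnitaryGroup (Fin N) ℂ) : Matrix (Fin N) (Fin N) ℂ) = exp (((t : ℝ) : ℂ) • Y) :=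
  rho_gexp (suGroupModel N) hY t

/-- **THE (0.4) LINEAR AVERAGE OF A ONE-FORM**: the mean of the loop sums over the index set plus the axial sum. [cite: Balaban1987RG1, (0.4) p.253] -/
def linAvg04 (a : PBond P j → ℝ) : PBond P (j + 1) → ℝ := fun c =>
  (Fintype.card (Idx P) : ℝ)⁻¹ * (∑ i, loopSum a c i) + axialSum a c

omit [NeZero N] in
/-- A real multiple of a real multiple. [folklore] -/
theorem real_smul_ofReal_smul (r t : ℝ) (M : Matrix (Fin N) (Fin N) ℂ) : r • (((t : ℝ) : ℂ) • M) = (((r * t : ℝ)) : ℂ) • M := by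
  rw [RCLike.real_smul_eq_coe_smul (K := ℂ), smul_smul, Complex.ofReal_mul]
  rfl

/-- **★ THE CORRECTION FACTOR OF AN ABELIAN CONFIGURATION IS `gexp` OF THE MEAN LOOP SUM** — on the guard (every loop variable within `δ_N` of `1`) and with every loop sum in the
principal-logarithm range (`|Σ|·‖Y‖ < ln 2`): `exp[mean_i log exp(Σ_i Y)] = exp((mean_i Σ_i)Y)`. [cite: Balaban1987RG1, (0.4) p.253] -/
theorem corr_gexpAt (a : PBond P j → ℝ) (c : PBond P (j + 1))
    (hδ : ∀ i, dist1 (loopHol (gexpAt (suGroupModel N) hY a) c i) < deltaSU (Fin N))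
    (hlog : ∀ i, |loopSum a c i| * ‖Y‖ < Real.log 2) :
    corr (expMeanLogSU (n := Fin N)) (gexpAt (suGroupModel N) hY a) c =
      gexp (suGroupModel N) hY ((Fintype.card (Idx P) : ℝ)⁻¹ * ∑ i, loopSum a c i) := by
  have hsm : Small (expMeanLogSU (n := Fin N)) (gexpAt (suGroupModel N) hY a) c := hδ
  unfold corr
  rw [if_pos hsm]
  -- the averaged family, re-indexed by the fixed enumeration
  set ι := Idx P
  set W : ι → Matrix.specialUnitaryGroup (Fin N) ℂ := loopHol (gexpAt (suGroupModel N) hY a) c with hW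
  have hWi : ∀ i, ((W i : Matrix.specialUnitaryGroup (Fin N) ℂ) : Matrix (Fin N) (Fin N) ℂ) = exp (((loopSum a c i : ℝ) : ℂ) • Y) := by
    intro i; rw [hW, loopHol_gexpAt, coe_gexp_su]
  have hguard : ∀ i : Fin (Fintype.card ι - 1 + 1), ‖(((W ∘ (LoopAverage.enum ι).symm) i : Matrix.specialUnitaryGroup (Fin N) ℂ) :
      Matrix (Fin N) (Fin N) ℂ) - 1‖ < deltaSU (Fin N) := fun i => hδ _
  apply Subtype.ext
  show (((expMeanLogSU (n := Fin N)).E (W ∘ (LoopAverage.enum ι).symm) : Matrix.specialUnitaryGroup (Fin N) ℂ) : Matrix (Fin N) (Fin N) ℂ) = _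
  rw [show (expMeanLogSU (n := Fin N)).E (W ∘ (LoopAverage.enum ι).symm) = ExpMeanLog.ESU (W ∘ (LoopAverage.enum ι).symm) from rfl,
    coe_ESU_of_small hguard, eml_eq_exp_sum, coe_gexp_su]
  congr 1
  -- the exponent: `Σ_i |I|⁻¹ log exp(Σ_i Y) = (|I|⁻¹ Σ_i Σ_i) Y`
  have hlog' : ∀ i : Fin (Fintype.card ι - 1 + 1),
      MatrixLog.mlog ((((W ∘ (LoopAverage.enum ι).symm) i : Matrix.specialUnitaryGroup (Fin N) ℂ) : Matrix (Fin N) (Fin N) ℂ)) =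
        (((loopSum a c ((LoopAverage.enum ι).symm i) : ℝ)) : ℂ) • Y := by
    intro i
    rw [Function.comp_apply, hWi, mlog_exp_real_smul (hlog _)]
  simp_rw [hlog', Fintype.card_fin, real_smul_ofReal_smul, ← Finset.sum_smul, ← Complex.ofReal_sum]
  congr 2
  have hcard : Fintype.card ι - 1 + 1 = Fintype.card ι := Nat.sub_add_cancel Fintype.card_pos
  have hc' : ((Fintype.card ι - 1 + 1 : ℕ) : ℝ) = ((Fintype.card ι : ℕ) : ℝ) := by exact_mod_cast hcard
  rw [Finset.mul_sum]
  rw [show (∑ i : Fin (Fintype.card ι - 1 + 1), ((Fintype.card ι - 1 + 1 : ℕ) : ℝ)⁻¹ * loopSum a c ((LoopAverage.enum ι).symm i)) =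
      ∑ i : Fin (Fintype.card ι - 1 + 1), (fun k : ι => ((Fintype.card ι : ℕ) : ℝ)⁻¹ * loopSum a c k) ((LoopAverage.enum ι).symm i) by
    refine Finset.sum_congr rfl fun i _ => ?_; beta_reduce; rw [hc']]
  exact Equiv.sum_comp (LoopAverage.enum ι).symm (fun k : ι => ((Fintype.card ι : ℕ) : ℝ)⁻¹ * loopSum a c k)

/-- **★★ THE (0.4) BLOCK AVERAGE OF AN ABELIAN CONFIGURATION IS THE ABELIAN CONFIGURATION OF THE LINEARLY AVERAGED ONE-FORM** at every coarse bond where the loop variables are on the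
guard and the loop sums in the principal-logarithm range. [cite: Balaban1987RG1, (0.4) p.253] -/
theorem avgFun_gexpAt (a : PBond P j → ℝ) (c : PBond P (j + 1))
    (hδ : ∀ i, dist1 (loopHol (gexpAt (suGroupModel N) hY a) c i) < deltaSU (Fin N))
    (hlog : ∀ i, |loopSum a c i| * ‖Y‖ < Real.log 2) :
    avgFun (expMeanLogSU (n := Fin N)) (gexpAt (suGroupModel N) hY a) c = gexpAt (suGroupModel N) hY (linAvg04 a) c := by
  unfold avgFun
  rw [corr_gexpAt hY a c hδ hlog, axialAvg_gexpAt, gexp_add]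
  rfl

/-- The same for the `Averaging` structure `blockAvg` (pointwise at a bond). [cite: Balaban1987RG1, (0.4) p.253] -/
theorem blockAvg_gexpAt_apply (a : PBond P j → ℝ) (c : PBond P (j + 1))
    (hδ : ∀ i, dist1 (loopHol (gexpAt (suGroupModel N) hY a) c i) < deltaSU (Fin N))
    (hlog : ∀ i, |loopSum a c i| * ‖Y‖ < Real.log 2) :
    (blockAvg (P := P) (j := j) (expMeanLogSU (n := Fin N))).avg (gexpAt (suGroupModel N) hY a) c = gexpAt (suGroupModel N) hY (linAvg04 a) c := by
  rw [blockAvg_avg]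
  exact avgFun_gexpAt hY a c hδ hlog

end SUN

end Summit.QuantumFields.YangMills.Theorems.AbelianEML

end
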